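import Literature.NumberTheory.EllipticCurves.PAdicLFunctionBranch
import Literature.NumberTheory.EllipticCurves.PAdicLFunctionDistributionProofs
import Literature.NumberTheory.EllipticCurves.ModularSymbolsEichlerShimuraHoldsProofs
import HarnessLib

/-!
# The MINUS modular symbol `[r]⁻_f ∈ ℚ`, the minus Mazur–Swinnerton-Dyer measure, the odd branches
# `L_p(f, α, ω^i, T)` (`i` odd), and Birch's formula for odd characters (definitions + proved API)

Topic `NumberTheory/EllipticCurves`; namespace `Literature.NumberTheory.EllipticCurves`. Companion of
`PAdicLFunction` (item C19: `ratPlusSymbol`, `msdMeasure = μ⁺_{f,α}`, `padicLFunction`) and of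
`PAdicLFunctionBranch` (`padicLFunctionBranch f α i`, the `ω^i`-branches of the PLUS measure, whose
docstring records that "for ODD `i` the plus modular symbol gives `0` and the genuine odd branch needs
the MINUS symbol `[·]⁻` and `Ω⁻_f` … deliberately NOT here"). This file supplies exactly that,
mirroring the plus-side definitions symbol for symbol (Mazur–Tate–Teitelbaum 1986, Ch. I §8
"`[a/m]^±`", §10 (10.1) the measures `μ^±_{f,α}`, §13 the tame branches, §8 (8.6) Birch's formula):

* `ratMinusSymbol f r : ℚ` — the rational number `[r]⁻_f` with `([r]⁻_f : ℝ) = normalizedMinusSymbol f r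
  = im (minusSymbol f r) / Ω⁻_f` (`minusSymbol f r = ({∞,r} − {∞,−r})/2`, `im Λ_f = ℤ·Ω⁻_f/2`, item
  C9), junk `0` if no such rational exists; for a normalised newform with rational coefficients it
  exists (Manin–Drinfeld, the tree THEOREM `IsNewform0.exists_rat_smul_minusPeriod_holds`):
  `ratCast_ratMinusSymbol` (PROVED — unlike its plus twin, which was stated as a named fact before
  the Manin–Drinfeld proofs landed). API: `ratMinusSymbol_zero` (`[0]⁻ = 0`),
  `ratMinusSymbol_add_intCast` (`[r + n]⁻ = [r]⁻`, from `modularSymbol_add_intCast_holds`).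
* `msdMinusMeasure f α : (n : ℕ) → ZMod (p^n) → ℚ_[p]` — `μ⁻_{f,α}(a + pⁿℤ_p) = α⁻ⁿ[a/pⁿ]⁻ − α⁻ⁿ⁻¹[a/pⁿ⁻¹]⁻`
  (MTT (10.1) with the minus symbol; `μ⁻(ℤ_p) = (1 − α⁻¹)[0]⁻ = 0`, `msdMinusMeasure_zero`).
* `padicLMinusBranchRiemannSum / padicLMinusBranchCoeff / padicLFunctionMinusBranch f α i` — the
  `ω^i`-branches `∫ ω^i(x)(1+T)^{ℓ(x)} dμ⁻_{f,α}` of the MINUS measure, literally the formulas of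
  `PAdicLFunctionBranch` with `μ⁻` for `μ⁺`; for ODD `i` these are the odd branches `L_p(f, α, ω^i, T)`
  of Mazur–Tate–Teitelbaum §I.13 (for even `i` they vanish identically in the limit, just as the plus
  branches do for odd `i`; not proved here).
* `ratMinusTwistedSymbolSum f χ = ∑_{a mod m} χ(a) [a/m]⁻_f` (values in any field `R ⊇ ℚ`).
* **Birch's formula for ODD characters, PROVED** (`ratMinusTwistedSymbolSum_mul_minusPeriod_mul_I`):
  for a rational newform `f`, an odd primitive `χ` mod `m` and the entire continuation `L` of
  `L(f, χ̄, s)`: `(∑_a χ(a) [a/m]⁻_f) · Ω⁻_f · i = τ(χ) · L(f, χ̄, 1)` — from the tree theorems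
  `twisted_LValue_eq_holds` (Birch for `{∞, ·}`), `minusSymbol_eq_im_mul_I_holds`,
  `modularSymbol_add_intCast_holds`, `IsNewform0.exists_rat_smul_minusPeriod_holds`; the proof is the
  minus image of `ratTwistedSymbolSum_mul_plusPeriod_of` (`PAdicLFunctionProofs`).

NOT here (named, for the requesting seat): the distribution property and boundedness of `μ⁻_{f,α}`
and the convergence of the minus Riemann sums (the plus twins `msdMeasure_distribution_holds`,
`exists_norm_msdMeasure_le_holds`, `tendsto_padicLRiemannSum_holds` rest on the 1000-line Hecke
computation of `PAdicLFunctionDistributionProofs` for `[·]⁺`; the minus computation is identical in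
print — MTT (4.2) is stated for `{∞, ·}` — but not yet in the tree); the imaginary period `Ω⁻` of a
Weierstrass curve over `ℚ` and Pal 2012 Thm. 3.2 for `d < 0` (cf. `Pal2012/QuadraticTwistPeriod.lean`).
No named fact is introduced (D-0026): definitions + theorems only.

Motivation: BSD rank-`≤ 1` residual cell `b2b-bsdres`, sub-cell additive-p4 (research line V9,
`HOME/b2b-bsdres-additive-p4/V9-CHAIN.md`): for an additive prime `p ≡ 3 (mod 4)` of Kodaira type
`I₀*`/`I_n*` (757 of the 818 V9 pairs, and every Eisenstein question at `p = 3`) the relevant branch of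
the semistable twist `E♭ = E ⊗ χ_{p*}`, `p* = −p`, is the ODD branch `ω^{(p−1)/2}`, which lives on
the minus symbol. Requested in HOME/INBOX 2026-08-20T00:56Z item (4).

## References
* B. Mazur, J. Tate, J. Teitelbaum, *On `p`-adic analogues of the conjectures of Birch and
  Swinnerton-Dyer*, Invent. Math. 84 (1986) 1–48: Ch. I §8 (the symbols `[a/m]^±`, (8.6) Birch's
  formula), §10 (10.1) (the measures), §13 (branches). [MazurTateTeitelbaum1986Invent]
* J. E. Cremona, *Algorithms for modular elliptic curves*, 2nd ed. (1997), §2.8 (`Ω^±`, real and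
  imaginary periods, twisted `L`-values). [CremonaAlgorithms1997]
* Ju. I. Manin, *Parabolic points and zeta functions of modular curves* (1972), Cor. 3.6. [Manin1972]
-/

noncomputable section

open scoped MatrixGroups ModularForm

open CongruenceSubgroup Filter Topology Literature.NumberTheory.EllipticCurves.ModularForms

namespace Literature.NumberTheory.EllipticCurves

/-! ### The rational minus symbol `[r]⁻_f` -/

section MinusSymbol

variable {N : ℕ} (f : CuspForm (Gamma0 N) 2)

open Classical in
/-- The **rational minus symbol** `[r]⁻_f ∈ ℚ`: the rational number `q` with
`(q : ℝ) = normalizedMinusSymbol f r = im (minusSymbol f r) / Ω⁻_f` (item C9 conventions: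
`minusSymbol f r = ({∞, r} − {∞, −r})/2`, `im Λ_f = ℤ · Ω⁻_f/2`), if it exists, and the junk value `0`
otherwise; for a normalised newform with rational coefficients it exists for every `r`
(Manin–Drinfeld, `ratCast_ratMinusSymbol`). Twin of `ratPlusSymbol` (Mazur–Tate–Teitelbaum 1986,
§I.8: the symbols `[a/m]⁻`). [cite: MazurTateTeitelbaum1986Invent, §I.8] -/
def ratMinusSymbol (r : ℚ) : ℚ :=
  if h : ∃ q : ℚ, (q : ℝ) = normalizedMinusSymbol f r then h.choose else 0

/-- `minusSymbol f 0 = 0` (`{∞, 0} − {∞, −0} = 0`). [cite: MazurTateTeitelbaum1986Invent, §I.8] -/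
theorem minusSymbol_zero : minusSymbol f 0 = 0 := by
  simp [minusSymbol]

/-- `[0]⁻_f = 0` as a real number (`normalizedMinusSymbol f 0 = 0`). [cite: MazurTateTeitelbaum1986Invent, §I.8] -/
theorem normalizedMinusSymbol_zero : normalizedMinusSymbol f 0 = 0 := by
  simp [normalizedMinusSymbol, minusSymbol_zero]

/-- **`[0]⁻_f = 0`**: the minus symbol vanishes at `0` (so the minus measure has total mass
`μ⁻(ℤ_p) = 0` and the odd branches have no "`L(f,1)`" constant term).
[cite: MazurTateTeitelbaum1986Invent, §I.8] -/
theorem ratMinusSymbol_zero : ratMinusSymbol f 0 = 0 := by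
  have hex : ∃ q : ℚ, (q : ℝ) = normalizedMinusSymbol f 0 := ⟨0, by simp [normalizedMinusSymbol_zero]⟩
  rw [ratMinusSymbol, dif_pos hex]
  have h : ((hex.choose : ℚ) : ℝ) = 0 := hex.choose_spec.trans (normalizedMinusSymbol_zero f)
  exact_mod_cast h

variable [NeZero N]

/-- **`([r]⁻_f : ℝ) = im (minusSymbol f r) / Ω⁻_f` for a normalised newform with rational
coefficients** — the defining property of `ratMinusSymbol`, PROVED from Manin–Drinfeld for rational
newforms (`IsNewform0.exists_rat_smul_minusPeriod_holds`: `Ω⁻_f ≠ 0` and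
`im (minusSymbol f r) ∈ ℚ · Ω⁻_f`; Manin 1972, Cor. 3.6; Mazur–Tate–Teitelbaum 1986, §I.8: "the
`[a/m]^±` are rational"). [cite: MazurTateTeitelbaum1986Invent, §I.8] [cite: Manin1972, Cor. 3.6] -/
theorem ratCast_ratMinusSymbol (hf : IsNewform0 f) (hQ : coeffField f = ⊥) (r : ℚ) :
    (ratMinusSymbol f r : ℝ) = normalizedMinusSymbol f r := by
  obtain ⟨hΩ, hrat⟩ := IsNewform0.exists_rat_smul_minusPeriod_holds (f := f) hf hQ
  obtain ⟨q, hq⟩ := hrat r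
  have hn : normalizedMinusSymbol f r = q := by
    rw [normalizedMinusSymbol, hq, Rat.smul_def, mul_div_cancel_right₀ _ hΩ]
  have hex : ∃ q' : ℚ, (q' : ℝ) = normalizedMinusSymbol f r := ⟨q, hn.symm⟩
  rw [ratMinusSymbol, dif_pos hex]
  exact hex.choose_spec

/-- **`[r]⁻_f · Ω⁻_f · i = minusSymbol f r`** for a rational newform: the minus symbol is purely
imaginary (`minusSymbol_eq_im_mul_I_holds`: `minusSymbol f r = (im {∞, r}) · i` for real
coefficients) and `im (minusSymbol f r) = [r]⁻ Ω⁻` (`ratCast_ratMinusSymbol`). Cremona §2.8;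
Mazur–Tate–Teitelbaum §I.8. [cite: MazurTateTeitelbaum1986Invent, §I.8] -/
theorem ratMinusSymbol_mul_minusPeriod_mul_I (hf : IsNewform0 f) (hQ : coeffField f = ⊥) (r : ℚ) :
    (ratMinusSymbol f r : ℂ) * (minusPeriod f : ℂ) * Complex.I = minusSymbol f r := by
  obtain ⟨hΩ, -⟩ := IsNewform0.exists_rat_smul_minusPeriod_holds (f := f) hf hQ
  have hreal : ∀ n, (cuspCoeff f n).im = 0 := cuspCoeff_im_eq_zero_of_coeffField_eq_bot hQ
  have hM := minusSymbol_eq_im_mul_I_holds f hreal r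
  have him : (minusSymbol f r).im = (modularSymbol f r).im := by
    rw [hM, Complex.mul_im, Complex.ofReal_re, Complex.ofReal_im, Complex.I_re, Complex.I_im]
    ring
  have hcast : (ratMinusSymbol f r : ℝ) * minusPeriod f = (minusSymbol f r).im := by
    rw [ratCast_ratMinusSymbol f hf hQ r, normalizedMinusSymbol, div_mul_cancel₀ _ hΩ]
  rw [hM, ← him, ← hcast]
  push_cast
  ring

omit [NeZero N] in
/-- `minusSymbol f (r + n) = minusSymbol f r` for `n ∈ ℤ`, from `{∞, r + n} = {∞, r}`
(`modularSymbol_add_intCast_holds`; Manin 1972 §1.2, Mazur–Tate–Teitelbaum (4.2)).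
[cite: MazurTateTeitelbaum1986Invent, §I.4 (4.2)] -/
theorem minusSymbol_add_intCast [NeZero N] (r : ℚ) (n : ℤ) :
    minusSymbol f (r + n) = minusSymbol f r := by
  have h1 : modularSymbol f (r + n) = modularSymbol f r := by
    exact_mod_cast modularSymbol_add_intCast_holds f r n
  have h2 : modularSymbol f (-(r + n)) = modularSymbol f (-r) := by
    have := modularSymbol_add_intCast_holds f (-r) (-n)
    push_cast at this
    rw [← this]
    ring_nf
  simp only [minusSymbol, h1, h2]

/-- **`[r + n]⁻_f = [r]⁻_f`**: the rational minus symbol only depends on `r mod ℤ` (twin of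
`ratPlusSymbol_add_intCast`; Mazur–Tate–Teitelbaum 1986, §I.4 (4.2)).
[cite: MazurTateTeitelbaum1986Invent, §I.4 (4.2)] -/
theorem ratMinusSymbol_add_intCast (r : ℚ) (n : ℤ) :
    ratMinusSymbol f (r + n) = ratMinusSymbol f r := by
  have h3 : normalizedMinusSymbol f (r + n) = normalizedMinusSymbol f r := by
    simp only [normalizedMinusSymbol, minusSymbol_add_intCast]
  unfold ratMinusSymbol
  rw [h3]

end MinusSymbol

/-! ### The minus measure and the odd branches -/

section Measure

variable {N : ℕ} (f : CuspForm (Gamma0 N) 2) {p : ℕ} [Fact p.Prime]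

/-- The **minus Mazur–Swinnerton-Dyer / Mazur–Tate–Teitelbaum measure** `μ⁻_{f,α}` on the compact
opens `a + pⁿℤ_p` (`a : ZMod (p ^ n)`): `μ⁻(a + pⁿℤ_p) = α⁻ⁿ [a/pⁿ]⁻ − α⁻⁽ⁿ⁺¹⁾ [a/pⁿ⁻¹]⁻` for
`n ≥ 1`, and `μ⁻(ℤ_p) = (1 − α⁻¹)[0]⁻` (`= 0`, `msdMinusMeasure_zero`) — the formula (10.1) of
Mazur–Tate–Teitelbaum 1986 §I.10 (trivial Nebentypus) with the minus symbol `[·]⁻ = ratMinusSymbol f`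
cast `ℚ → ℚ_p`, `a` represented by `a.val` (any representative: `ratMinusSymbol_add_intCast`).
Twin of `msdMeasure`. Junk (harmless) for `α = 0`. [cite: MazurTateTeitelbaum1986Invent, §I.10 (10.1)] -/
def msdMinusMeasure (α : ℚ_[p]) : (n : ℕ) → ZMod (p ^ n) → ℚ_[p]
  | 0, _ => (1 - α⁻¹) * (ratMinusSymbol f 0 : ℚ_[p])
  | n + 1, a =>
    α⁻¹ ^ (n + 1) * (ratMinusSymbol f ((a.val : ℚ) / (p : ℚ) ^ (n + 1)) : ℚ_[p]) -
      α⁻¹ ^ (n + 2) * (ratMinusSymbol f ((a.val : ℚ) / (p : ℚ) ^ n) : ℚ_[p])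

/-- `μ⁻_{f,α}(ℤ_p) = 0` (because `[0]⁻ = 0`): the minus measure has no mass in total, matching the
absence of a constant term in the odd branches. [cite: MazurTateTeitelbaum1986Invent, §I.10 (10.1)] -/
theorem msdMinusMeasure_zero (α : ℚ_[p]) (a : ZMod (p ^ 0)) : msdMinusMeasure f α 0 a = 0 := by
  simp [msdMinusMeasure, ratMinusSymbol_zero]

/-- The `n`-th **Riemann sum** for the `k`-th coefficient of the `ω^i`-branch of the MINUS measure:
`∑_ζ ζ^i ∑_{s mod pⁿ} μ⁻_{f,α}(ζ γˢ + p^{n+e₀}ℤ_p) · (s choose k)` — literally `padicLBranchRiemannSum`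
with `μ⁻` for `μ⁺` (`ζ` over the Teichmüller representatives = torsion of `ℤ_p^×` — the binder is
not called `η` here because `η` is the scoped Dedekind-eta notation of `ModularForm`;
`γ = cyclotomicGenerator p`).
Mazur–Tate–Teitelbaum 1986, §I.13. [cite: MazurTateTeitelbaum1986Invent, §I.13] -/
def padicLMinusBranchRiemannSum (α : ℚ_[p]) (i k n : ℕ) : ℚ_[p] :=
  ∑ᶠ ζ : rootsOfUnity (torsionOrder p) ℤ_[p], ∑ s : ZMod (p ^ n),
    ((((ζ : ℤ_[p]ˣ) : ℤ_[p]) : ℚ_[p]) ^ i *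
      msdMinusMeasure f α (n + cyclotomicExponent p)
          (PadicInt.toZModPow (n + cyclotomicExponent p) ((ζ : ℤ_[p]ˣ) : ℤ_[p]) *
            (cyclotomicGenerator p : ZMod (p ^ (n + cyclotomicExponent p))) ^ s.val) *
        (s.val.choose k : ℚ_[p]))

/-- The `k`-th **coefficient of the `ω^i`-branch of the minus measure**:
`∫_{ℤ_p^×} ω^i(x) (ℓ(x) choose k) dμ⁻_{f,α}(x) = lim_n padicLMinusBranchRiemannSum f α i k n`
(junk value of `limUnder` if the limit does not exist, as for `padicLBranchCoeff`).
Mazur–Tate–Teitelbaum 1986, §I.11–I.13. [cite: MazurTateTeitelbaum1986Invent, §I.11–I.13] -/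
def padicLMinusBranchCoeff (α : ℚ_[p]) (i k : ℕ) : ℚ_[p] :=
  limUnder atTop (padicLMinusBranchRiemannSum f α i k)

/-- The **`ω^i`-branch of the `p`-adic `L`-function built on the MINUS measure**,
`L⁻_p(f, α, ω^i, T) = ∫_{ℤ_p^×} ω^i(x) (1 + T)^{ℓ(x)} dμ⁻_{f,α}(x) ∈ ℚ_p⟦T⟧`; for ODD `i` this is
the odd tame branch `L_p(f, α, ω^i, T)` of Mazur–Tate–Teitelbaum §I.13 (whose special values are
`τ(ω^i κ) L(f, ω^{-i} κ̄, 1)/Ω⁻_f` up to the usual factors, §I.14; Birch's formula for odd characters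
below). Twin of `padicLFunctionBranch`. [cite: MazurTateTeitelbaum1986Invent, §I.13] -/
def padicLFunctionMinusBranch (α : ℚ_[p]) (i : ℕ) : PowerSeries ℚ_[p] :=
  PowerSeries.mk (padicLMinusBranchCoeff f α i)

/-- The `k`-th coefficient of `L⁻_p(f, α, ω^i, T)` is `padicLMinusBranchCoeff f α i k` (unfolding;
MTT §I.13). [cite: MazurTateTeitelbaum1986Invent, §I.13] -/
@[simp] theorem coeff_padicLFunctionMinusBranch (α : ℚ_[p]) (i k : ℕ) :
    PowerSeries.coeff k (padicLFunctionMinusBranch f α i) = padicLMinusBranchCoeff f α i k :=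
  PowerSeries.coeff_mk _ _

/-- The constant term of `L⁻_p(f, α, ω^i, T)` is `padicLMinusBranchCoeff f α i 0 = ∫ ω^i dμ⁻_{f,α}`
(unfolding; MTT §I.13). [cite: MazurTateTeitelbaum1986Invent, §I.13] -/
@[simp] theorem constantCoeff_padicLFunctionMinusBranch (α : ℚ_[p]) (i : ℕ) :
    PowerSeries.constantCoeff (padicLFunctionMinusBranch f α i) = padicLMinusBranchCoeff f α i 0 :=
  PowerSeries.constantCoeff_mk

/-- The **minus twisted symbol sum** `∑_{a mod m} χ(a) [a/m]⁻_f` of a Dirichlet character `χ` mod `m`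
with values in a field `R` of characteristic zero (`[·]⁻ = ratMinusSymbol`, cast `ℚ → R`); twin of
`ratTwistedSymbolSum`. For `R = ℂ`, `χ` odd primitive and `f` a rational newform it equals
`τ(χ) L(f, χ̄, 1) / (Ω⁻_f · i)` (`ratMinusTwistedSymbolSum_mul_minusPeriod_mul_I`, Birch's formula).
Mazur–Tate–Teitelbaum 1986, §I.8 (8.6). [cite: MazurTateTeitelbaum1986Invent, §I.8 (8.6)] -/
def ratMinusTwistedSymbolSum {R : Type*} [Field R] {m : ℕ} [NeZero m]
    (χ : DirichletCharacter R m) : R :=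
  ∑ a : ZMod m, χ a * (ratMinusSymbol f ((a.val : ℚ) / m) : R)

end Measure

/-! ### Birch's formula for odd characters (proved) -/

section Birch

variable {N : ℕ} [NeZero N] (f : CuspForm (Gamma0 N) 2)

/-- **Birch's formula for `[·]⁻` (odd characters), PROVED.** For a normalised newform
`f ∈ S₂(Γ₀(N))` with rational coefficients, an ODD primitive Dirichlet character `χ` mod `m` and the
entire continuation `L` of `L(f, χ̄, s)` (`twistedLSeries f χ⁻¹`):
`(∑_{a mod m} χ(a) [a/m]⁻_f) · Ω⁻_f · i = τ(χ) · L(f, χ̄, 1)`, `τ(χ) = gaussSum χ stdAddChar`.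
Proof (the minus image of `ratTwistedSymbolSum_mul_plusPeriod_of`): Birch's formula for `{∞, ·}`
(`twisted_LValue_eq_holds`: `τ(χ) L(f, χ̄, 1) = ∑_a χ(a) {∞, a/m}`); for odd `χ`,
`∑ χ(a) minusSymbol f (a/m) = ∑ χ(a) {∞, a/m}` (pair `a ↔ −a`, `{∞, (m−a)/m} = {∞, −a/m}` by
`modularSymbol_add_intCast_holds`, `χ(−a) = −χ(a)`); and `minusSymbol f r = [r]⁻ Ω⁻ i`
(`ratMinusSymbol_mul_minusPeriod_mul_I`). Mazur–Tate–Teitelbaum 1986, §I.8, (8.6); Cremona §2.8.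
[cite: MazurTateTeitelbaum1986Invent, §I.8 (8.6)] -/
theorem ratMinusTwistedSymbolSum_mul_minusPeriod_mul_I (hf : IsNewform0 f) (hQ : coeffField f = ⊥)
    {m : ℕ} [NeZero m] {χ : DirichletCharacter ℂ m} (hχ : χ.IsPrimitive) (hχo : χ.Odd)
    {L : ℂ → ℂ} (hL : Differentiable ℂ L) (hL' : ∀ s : ℂ, 2 < s.re → L s = twistedLSeries f χ⁻¹ s) :
    ratMinusTwistedSymbolSum f χ * (minusPeriod f : ℂ) * Complex.I =
      gaussSum χ (ZMod.stdAddChar (N := m)) * L 1 := by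
  have htr := modularSymbol_add_intCast_holds f
  -- (i) `∑ χ(a) minusSymbol f (a/m) = ∑ χ(a) {∞, a/m}` for odd `χ`
  have hneg : ∀ a : ZMod m,
      modularSymbol f (((-a).val : ℚ) / m) = modularSymbol f (-((a.val : ℚ) / m)) := by
    intro a
    rw [ZMod.neg_val]
    split_ifs with ha
    · subst ha; simp
    · rw [Nat.cast_sub a.val_lt.le]
      have hm : (m : ℚ) ≠ 0 := by exact_mod_cast NeZero.ne m
      have : ((m : ℚ) - a.val) / m = -((a.val : ℚ) / m) + ((1 : ℤ) : ℚ) := by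
        field_simp
        ring
      rw [this, htr]
  have hsum2 :
      ∑ a : ZMod m, χ a * modularSymbol f (-((a.val : ℚ) / m)) = -twistedSymbolSum f χ := by
    rw [twistedSymbolSum, ← Finset.sum_neg_distrib]
    refine Fintype.sum_equiv (Equiv.neg (ZMod m)) _ _ fun a ↦ ?_
    rw [Equiv.neg_apply, hneg, DirichletCharacter.Odd.eval_neg χ a hχo]
    ring
  have hsum : ∑ a : ZMod m, χ a * minusSymbol f ((a.val : ℚ) / m) = twistedSymbolSum f χ := by
    have hsplit : ∀ a : ZMod m, χ a * minusSymbol f ((a.val : ℚ) / m) =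
        (χ a * modularSymbol f ((a.val : ℚ) / m) -
          χ a * modularSymbol f (-((a.val : ℚ) / m))) / 2 := fun a ↦ by
      rw [minusSymbol]
      ring
    simp_rw [hsplit]
    rw [← Finset.sum_div, Finset.sum_sub_distrib, hsum2, ← twistedSymbolSum]
    ring
  -- (ii) Birch's formula for `χ⁻¹`
  have hχ' : χ⁻¹.IsPrimitive := by
    rw [DirichletCharacter.isPrimitive_def, DirichletCharacter.conductor_inv]; exact hχ
  have hB := twisted_LValue_eq_holds f (m := m) hχ' hL hL'
  rw [inv_inv] at hB
  rw [hB, ← hsum, ratMinusTwistedSymbolSum, Finset.sum_mul, Finset.sum_mul]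
  refine Finset.sum_congr rfl fun a _ ↦ ?_
  rw [mul_assoc, mul_assoc, ← mul_assoc (ratMinusSymbol f _ : ℂ),
    ratMinusSymbol_mul_minusPeriod_mul_I f hf hQ]

end Birch

end Literature.NumberTheory.EllipticCurves

end
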